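import Mathlib
import Literature.NumberTheory.Transcendental.KZCalculus

/-!
# The hyperbolic scissors ladder inside the Kontsevich–Zagier calculus (definitions)

Goncharov's ladder [Goncharov 1999, §§1.1–1.7]: volumes of `ℚ̄`-geodesic polytopes of hyperbolic `(2m−1)`-space are
weight-`m` periods (polylogarithms at algebraic points; `m = 2` is the Bloch–Wigner dilogarithm of ideal tetrahedra,
[Dupont–Sah 1982], [Neumann 1998]), and their scissors-congruence relations are the motivic relations of weight `m`.
This file fixes the objects needed to read the ladder INSIDE the calculus of moves `KZCalculus`. Rung `n` lives in
the upper half-space model `ℝⁿ × ℝ₊` of hyperbolic `(n+1)`-space (coordinates `p : Fin (n + 1) → ℝ`, height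
`t = p (Fin.last n)`) with the RATIONAL volume density `t^{-(n+1)}`; its objects are the `ℚ̄`-geodesic polytopes
(finite intersections of geodesic half-spaces — vertical hyperplanes and hemispheres centred on the boundary —
with real-algebraic parameters, of finite volume), and its scissors-congruence presentation has two kinds of
relators: almost-everywhere dissections and `ℚ̄`-Möbius congruences, the Möbius group of the half-space being
generated by the similarities `p ↦ (c A x + b, c t)` (`A` orthogonal) and the unit inversion `p ↦ p / ‖p‖²`
(Liouville; Bruhat decomposition). Rung `n = 2` contains the route's ideal tetrahedra `T(z)`; rung `n = 4` is
Goncharov's weight-three rung (volumes of `ℚ̄`-simplices of `ℍ⁵` are trilogarithmic).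

## Main definitions (namespace `Literature.NumberTheory.Transcendental.KZ`)

* `upperHalfSpace n`, `hypDensity n` — the model and its volume density `t^{-(n+1)}`;
* `unitInversion n`, `boundarySimilarity n c A b` — the two generating Möbius moves;
* `IsGeodesicPolytope n P` — `P` is a finite-volume `ℚ̄`-geodesic polytope of `ℍⁿ⁺¹`;
* `IsLadderFamily n ρ` — `ρ` chooses a KZ integral representation `[P, t^{-(n+1)}]` on every polytope;
* `scissorsRelators n` — dissection and congruence relators in `FreeAbelianGroup (Set (Fin (n+1) → ℝ))`;
* `rungRelators n` — the value-relators `Σ mᵢ•[ρ Pᵢ]` (`Σ mᵢ vol Pᵢ = 0`) of rung `n` in `KZ.FormalRep`;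
  `ladderRelators` — their union over all rungs.

## References

* A. B. Goncharov, *Volumes of hyperbolic manifolds and mixed Tate motives*, JAMS 12 (1999), §§1.1–1.7.
* J. L. Dupont, C.-H. Sah, *Scissors congruences II*, J. Pure Appl. Algebra 25 (1982), §§2–5.
* R. Benedetti, C. Petronio, *Lectures on Hyperbolic Geometry* (1992), A.3–A.4 (Möbius group of the half-space).
* W. D. Neumann, *Hilbert's 3rd problem and invariants of 3-manifolds*, Geom. Topol. Monogr. 1 (1998), §2.
* M. Kontsevich, D. Zagier, *Periods* (2001), §1.2.

## Design notes

* No statement is asserted here (definitions only); the transfer theorems (each scissors relator is a KZ relation: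
  the unit inversion and the similarities are single `changeOfVariablesRel` moves for the density `t^{-(n+1)}`, a.e.
  dissections are iterated `domainAddRel`) and the conjectural inputs (volume injectivity per rung) live with their users.
* Polytopes are OPEN sets cut out by strict inequalities; faces are Lebesgue-null, so dissections are stated almost
  everywhere (`volume (P ∖ (P₁ ∪ P₂)) = 0`), matching `KZ.of_sub_sum_of_mem_relations`.
* The Möbius congruences are listed by GENERATORS (unit inversion; boundary similarities with orthogonal linear part);
  every `ℚ̄`-Möbius map of the half-space is a word in them (Bruhat decomposition), and a congruence by a word is a sum
  of generator congruences, so `scissorsRelations` is the usual group of `ℚ̄`-scissors relations.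
-/

noncomputable section

open Set _root_.MeasureTheory

namespace Literature.NumberTheory.Transcendental

namespace KZ

/-- The upper half-space model `{p | 0 < p (last)}` of hyperbolic `(n+1)`-space in `Fin (n + 1) → ℝ`.
[cite: BenedettiPetronio1992, A.3] -/
def upperHalfSpace (n : ℕ) : Set (Fin (n + 1) → ℝ) := {p | 0 < p (Fin.last n)}

/-- Membership in the upper half-space. [folklore] -/
@[simp] theorem mem_upperHalfSpace {n : ℕ} (p : Fin (n + 1) → ℝ) :
    p ∈ upperHalfSpace n ↔ 0 < p (Fin.last n) := Iff.rfl

/-- The hyperbolic volume density `t^{-(n+1)}` of the upper half-space model of `ℍⁿ⁺¹`, a RATIONAL function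
of the coordinates. [cite: BenedettiPetronio1992, A.3] -/
def hypDensity (n : ℕ) (p : Fin (n + 1) → ℝ) : ℝ := 1 / p (Fin.last n) ^ (n + 1)

/-- The unit inversion `p ↦ p / ‖p‖²` of `Fin (n + 1) → ℝ` (inversion in the unit sphere centred at the
boundary point `0`; a hyperbolic isometry of the upper half-space). [cite: BenedettiPetronio1992, A.3.5] -/
def unitInversion (n : ℕ) (p : Fin (n + 1) → ℝ) : Fin (n + 1) → ℝ := fun l => p l / ∑ m, p m ^ 2

/-- The boundary-fixing similarity `p = (x, t) ↦ (c • A x + b, c t)` of `Fin (n + 1) → ℝ` (`x = Fin.init p`,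
`t = p (Fin.last n)`): a Euclidean similarity of the boundary `ℝⁿ` extended to the half-space; a hyperbolic
isometry when `A` is orthogonal and `c > 0`. [cite: BenedettiPetronio1992, A.3.5] -/
def boundarySimilarity (n : ℕ) (c : ℝ) (A : Matrix (Fin n) (Fin n) ℝ) (b : Fin n → ℝ) (p : Fin (n + 1) → ℝ) :
    Fin (n + 1) → ℝ :=
  Fin.snoc (α := fun _ => ℝ) (c • A.mulVec (Fin.init p) + b) (c * p (Fin.last n))

/-- `P ⊆ ℝⁿ × ℝ₊` is a (finite-volume, open) `ℚ̄`-GEODESIC POLYTOPE of `ℍⁿ⁺¹`: the intersection of the open upper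
half-space with finitely many open geodesic half-spaces, each bounded either by a vertical hyperplane
`Σ aₗ pₗ = c` (`a (last) = 0`) or by a hemisphere `Σ (pₗ − aₗ)² = c` centred on the boundary (`a (last) = 0`),
all parameters `aₗ, c` real algebraic, the side chosen by a sign `ε = ±1`; and `t^{-(n+1)}` is integrable on
`P` (finite hyperbolic volume: ideal vertices allowed, no infinite ends). Rung `n = 2` contains the ideal
tetrahedra `T(z)`, `z ∈ ℚ̄`; rung `n = 4` the `ℚ̄`-simplices of `ℍ⁵`. [cite: Goncharov1999, §1.1] -/
def IsGeodesicPolytope (n : ℕ) (P : Set (Fin (n + 1) → ℝ)) : Prop :=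
  ∃ (k : ℕ) (flat : Fin k → Bool) (a : Fin k → Fin (n + 1) → ℝ) (c : Fin k → ℝ) (ε : Fin k → ℝ),
    (∀ i l, IsAlgebraic ℚ (a i l)) ∧ (∀ i, IsAlgebraic ℚ (c i)) ∧ (∀ i, ε i = 1 ∨ ε i = -1) ∧
    (∀ i, a i (Fin.last n) = 0) ∧
    P = {p | 0 < p (Fin.last n) ∧ ∀ i, 0 < ε i *
      (if flat i then (∑ l, a i l * p l) - c i else (∑ l, (p l - a i l) ^ 2) - c i)} ∧
    IntegrableOn (hypDensity n) P

/-- An ADMISSIBLE LADDER FAMILY at rung `n`: a choice, for every `ℚ̄`-geodesic polytope `P`, of a KZ integral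
representation with domain `P` and integrand `t^{-(n+1)}` on it (the hyperbolic volume of `P` as a
Kontsevich–Zagier period `[P, t^{-(n+1)}]`). [cite: KontsevichZagier2001, §1.1] -/
def IsLadderFamily (n : ℕ) (ρ : Set (Fin (n + 1) → ℝ) → IntegralRep (n + 1)) : Prop :=
  ∀ P, IsGeodesicPolytope n P → (ρ P).domain = P ∧ EqOn (ρ P).integrand (hypDensity n) P

/-- The SCISSORS RELATORS of rung `n` in the free abelian group on subsets of `ℝⁿ × ℝ₊`: (i) almost-everywhere
dissections `[P] − [P₁] − [P₂]` (`P₁, P₂ ⊆ P` polytopes, `P₁ ∩ P₂` and `P ∖ (P₁ ∪ P₂)` Lebesgue-null), and the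
`ℚ̄`-Möbius congruences `[g P] − [P]` for the two generating moves `g`: (ii) the unit inversion and (iii) the
boundary-fixing similarities `(x, t) ↦ (c A x + b, c t)` with `c > 0`, `A` orthogonal, `c, A, b` real algebraic
(`g P` again a polytope). By the Bruhat decomposition of the Möbius group these congruences generate all
`ℚ̄`-Möbius congruences of the half-space. [cite: DupontSah1982, §2] -/
def scissorsRelators (n : ℕ) : Set (FreeAbelianGroup (Set (Fin (n + 1) → ℝ))) :=
  {x | ∃ P P₁ P₂ : Set (Fin (n + 1) → ℝ), IsGeodesicPolytope n P ∧ IsGeodesicPolytope n P₁ ∧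
      IsGeodesicPolytope n P₂ ∧ P₁ ⊆ P ∧ P₂ ⊆ P ∧ volume (P₁ ∩ P₂) = 0 ∧ volume (P \ (P₁ ∪ P₂)) = 0 ∧
      x = FreeAbelianGroup.of P - FreeAbelianGroup.of P₁ - FreeAbelianGroup.of P₂} ∪
  {x | ∃ P P' : Set (Fin (n + 1) → ℝ), IsGeodesicPolytope n P ∧ IsGeodesicPolytope n P' ∧
      P' = unitInversion n '' P ∧ x = FreeAbelianGroup.of P' - FreeAbelianGroup.of P} ∪
  {x | ∃ (P P' : Set (Fin (n + 1) → ℝ)) (c : ℝ) (A : Matrix (Fin n) (Fin n) ℝ) (b : Fin n → ℝ),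
      IsGeodesicPolytope n P ∧ IsGeodesicPolytope n P' ∧ IsAlgebraic ℚ c ∧ 0 < c ∧
      (∀ i j, IsAlgebraic ℚ (A i j)) ∧ A.transpose * A = 1 ∧ (∀ i, IsAlgebraic ℚ (b i)) ∧
      P' = boundarySimilarity n c A b '' P ∧ x = FreeAbelianGroup.of P' - FreeAbelianGroup.of P}

/-- The subgroup of scissors relations of rung `n` (the `ℚ̄`-scissors congruence group of `ℍⁿ⁺¹` is the quotient
of the free abelian group on polytopes by it). [cite: DupontSah1982, §2] -/
def scissorsRelations (n : ℕ) : AddSubgroup (FreeAbelianGroup (Set (Fin (n + 1) → ℝ))) :=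
  AddSubgroup.closure (scissorsRelators n)

/-- The VALUE-RELATORS of rung `n` in `KZ.FormalRep`: the formal combinations `Σ mᵢ • [ρ Pᵢ]` of representations
of an admissible ladder family on `ℚ̄`-geodesic polytopes `Pᵢ` of `ℍⁿ⁺¹` whose volumes satisfy the `ℤ`-linear
relation `Σ mᵢ · vol Pᵢ = 0` (same shape as the tetrahedral value-relators adjoined by the crux
`OffTetraSectorKernel`, which are the case `n = 2`, `Pᵢ = T(zᵢ)`). [cite: Goncharov1999, §1.7] -/
def rungRelators (n : ℕ) : Set FormalRep :=
  {d | ∃ ρ : Set (Fin (n + 1) → ℝ) → IntegralRep (n + 1), IsLadderFamily n ρ ∧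
      ∃ (k : ℕ) (P : Fin k → Set (Fin (n + 1) → ℝ)) (m : Fin k → ℤ), (∀ i, IsGeodesicPolytope n (P i)) ∧
        ∑ i, (m i : ℝ) * (ρ (P i)).value = 0 ∧ d = ∑ i, m i • of (ρ (P i))}

/-- The value-relators of the whole hyperbolic scissors ladder (all rungs `n ≥ 0`). [cite: Goncharov1999, §1.7] -/
def ladderRelators : Set FormalRep := ⋃ n, rungRelators n

end KZ

end Literature.NumberTheory.Transcendental

end
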